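import Summits.BirchSwinnertonDyer.Rank1Residual.Supersingular.MazurTateLayerConsistency
import HarnessLib

/-!
# Mazur–Tate certificates, minimal form: `θ_n ≠ 0`, `μ(θ_n) = 0`, `λ(θ_n) = deg ω_n^± + l` at ONE
# layer ⇒ `(μ, λ)(L^•) = (0, l)` — the bound `λ(θ_n) < pⁿ` is automatic
# (cell `b2b-bsdres`, supersingular family, prover B = unit `b2b-bsdres-additive-p3`, gen 4)

HONEST FRAMING (run/shared/lean/b2b/bsd-rank1-residual/, verbatim in every file): the goal of the
cell is to DELETE the COMBINATION-SHAPED residual classes of the Birch–Swinnerton-Dyer formula for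
ALL analytic-rank `≤ 1` elliptic curves over `ℚ` — "full BSD formula for every rank `≤ 1` curve in
class `C`" assembled STRICTLY from published theorems — so that the rank-`≤ 1` remainder becomes
exactly the CONSTRUCTION-SHAPED classes, which are TYPED (missing-input `Prop`s), NOT attempted.
This is not "finishing BSD". THEOREMS ONLY; nothing about any curve is asserted; nothing booked;
labels unchanged. Census-support bookkeeping.

`lam_lt_of_mazurTate`: for `Θ ∈ Λ` with `ι Θ = θ_n`, `Θ ≠ 0`, `μ(Θ) = 0`, automatically
`λ(Θ) < pⁿ` (`deg θ_n < pⁿ`, `natDegree_mazurTateElement_lt`, p214879). Hence the primed, minimal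
certificate theorems `lam_sharp_eq_of_mazurTate'`, `lam_flat_eq_of_mazurTate'`,
`lam_signed_neg_one_eq_of_mazurTate'`, `lam_signed_one_eq_of_mazurTate'`: the per-pair datum is
EXACTLY (layer `n` of the right parity, `θ_n ≢ 0 (mod p)`, `λ(θ_n) = deg ω_n^± + l`) — what the
INBOX request of 2026-08-20T10:30Z asks the census seats to print (two engines).

References: [Pollack2003] Def. 6.15, Rem. 6.16, Prop. 6.9–6.10; [Sprung2017] §3, Cor. 3.6, Thm. 1.12.
Memo: `HOME/b2b-bsdres-additive-p3/X8-ROUTE-B.md` §9 (gen 4).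
-/

set_option autoImplicit false

noncomputable section

open scoped Classical MatrixGroups ModularForm

open CongruenceSubgroup Polynomial WeierstrassCurve Literature.NumberTheory.EllipticCurves
  Literature.NumberTheory.EllipticCurves.ModularForms
  Literature.NumberTheory.EllipticCurves.Sprung2017
  Summit.BirchSwinnertonDyer.Rank1Residual.X1.MuLambda

namespace Summit.BirchSwinnertonDyer.Rank1Residual.Supersingular

/-! ## `λ(θ_n) < pⁿ` is automatic — the certificate theorems without the `hlt` binder -/

section Automatic

variable {W : WeierstrassCurve ℚ} [W.IsElliptic] [W.IsGloballyMinimal] {N : ℕ} [NeZero N]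
  {f : CuspForm (Gamma0 N) 2} {p : ℕ} [hp : Fact p.Prime]

omit [NeZero N] in
/-- **`λ(θ_n) < pⁿ` automatically**: for `Θ ∈ Λ` with `ι Θ = θ_n`, `Θ ≠ 0` and `μ(Θ) = 0`, the
reduction `Θ̄ ≠ 0` has no coefficients in degrees `≥ pⁿ` (`deg θ_n < pⁿ`), so its order is `< pⁿ`.
Hence the hypothesis `hlt` of the certificate theorems (`lam_sharp/flat_eq_of_mazurTate`, p214576) is
redundant. [cite: Pollack2003, Def. 6.15 and Remark 6.16] -/
theorem lam_lt_of_mazurTate {n : ℕ} {Θ : IwasawaAlgebra p}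
    (hΘ : iwasawaToPowerSeries p Θ =
      ((mazurTateElement f p n).map (algebraMap ℚ ℚ_[p]) : PowerSeries ℚ_[p]))
    (hΘ0 : Θ ≠ 0) (hμ : mu Θ = 0) : lam Θ < p ^ n := by
  have hred : red Θ ≠ 0 := red_ne_zero_of_mu_eq_zero hΘ0 hμ
  obtain ⟨-, hlam⟩ := mu_eq_zero_and_lam_eq_of_red_ne_zero hred
  by_contra hge
  rw [not_lt] at hge
  have hord : ((p ^ n : ℕ) : ℕ∞) ≤ (red Θ).order := by
    rw [← hlam]
    exact_mod_cast hge
  exact hred (eq_zero_of_le_order_of_coeff_eq_zero hord fun i hi ↦ by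
    rw [red, PowerSeries.coeff_map, coeff_eq_zero_of_iwasawaToPowerSeries_eq hΘ hi, map_zero])

/-- **`(μ, λ)(L♯)` from ONE odd-level Mazur–Tate certificate, minimal form** (no `hlt`): `Θ ≠ 0`,
`μ(Θ) = 0`, `λ(Θ) = deg ω_n^+ + l` at an odd layer `n` ⇒ `μ(L♯) = 0 ∧ λ(L♯) = l`.
[cite: Pollack2003, Prop. 6.9 and Prop. 6.10] [cite: Sprung2017, §3 and Cor. 3.6, Thm. 1.12] -/
theorem lam_sharp_eq_of_mazurTate' (hp2 : p ≠ 2) (hf : IsNewformOf W f)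
    (hgood : W.HasGoodReductionAtPrime p) (hap : (p : ℤ) ∣ W.frobeniusTrace p)
    {Lsharp Lflat : IwasawaAlgebra p} (hSP : IsSprungPair f p (W.frobeniusTrace p) Lsharp Lflat)
    {n : ℕ} (hn : Odd n) {Θ : IwasawaAlgebra p}
    (hΘ : iwasawaToPowerSeries p Θ =
      ((mazurTateElement f p n).map (algebraMap ℚ ℚ_[p]) : PowerSeries ℚ_[p]))
    (hΘ0 : Θ ≠ 0) (hμ : mu Θ = 0) {l : ℕ}
    (hlam : lam Θ = (cyclotomicOmegaPlus p n).natDegree + l) : mu Lsharp = 0 ∧ lam Lsharp = l :=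
  lam_sharp_eq_of_mazurTate hp2 hf hgood hap hSP hn hΘ hΘ0 hμ hlam (lam_lt_of_mazurTate hΘ hΘ0 hμ)

/-- **`(μ, λ)(L♭)` from ONE even-level Mazur–Tate certificate, minimal form** (no `hlt`).
[cite: Pollack2003, Prop. 6.9 and Prop. 6.10] [cite: Sprung2017, §3 and Cor. 3.6, Thm. 1.12] -/
theorem lam_flat_eq_of_mazurTate' (hp2 : p ≠ 2) (hf : IsNewformOf W f)
    (hgood : W.HasGoodReductionAtPrime p) (hap : (p : ℤ) ∣ W.frobeniusTrace p)
    {Lsharp Lflat : IwasawaAlgebra p} (hSP : IsSprungPair f p (W.frobeniusTrace p) Lsharp Lflat)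
    {n : ℕ} (hn : Even n) {Θ : IwasawaAlgebra p}
    (hΘ : iwasawaToPowerSeries p Θ =
      ((mazurTateElement f p n).map (algebraMap ℚ ℚ_[p]) : PowerSeries ℚ_[p]))
    (hΘ0 : Θ ≠ 0) (hμ : mu Θ = 0) {l : ℕ}
    (hlam : lam Θ = (cyclotomicOmegaMinus p n).natDegree + l) : mu Lflat = 0 ∧ lam Lflat = l :=
  lam_flat_eq_of_mazurTate hp2 hf hgood hap hSP hn hΘ hΘ0 hμ hlam (lam_lt_of_mazurTate hΘ hΘ0 hμ)

/-- **`a_p = 0`, `ε = −1`, minimal form** (no `hlt`). [cite: Pollack2003, Prop. 6.9, Prop. 6.10 and Prop. 6.18] -/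
theorem lam_signed_neg_one_eq_of_mazurTate' (hp2 : p ≠ 2) (hf : IsNewformOf W f)
    (hgood : W.HasGoodReductionAtPrime p) (hap : W.frobeniusTrace p = 0)
    {L : IwasawaAlgebra p} (hL : Kobayashi2003.IsSignedPAdicLFunction f p (-1) L)
    {n : ℕ} (hn : Odd n) {Θ : IwasawaAlgebra p}
    (hΘ : iwasawaToPowerSeries p Θ =
      ((mazurTateElement f p n).map (algebraMap ℚ ℚ_[p]) : PowerSeries ℚ_[p]))
    (hΘ0 : Θ ≠ 0) (hμ : mu Θ = 0) {l : ℕ}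
    (hlam : lam Θ = (cyclotomicOmegaPlus p n).natDegree + l) : mu L = 0 ∧ lam L = l :=
  lam_signed_neg_one_eq_of_mazurTate hp2 hf hgood hap hL hn hΘ hΘ0 hμ hlam
    (lam_lt_of_mazurTate hΘ hΘ0 hμ)

/-- **`a_p = 0`, `ε = 1`, minimal form** (no `hlt`). [cite: Pollack2003, Prop. 6.9, Prop. 6.10 and Prop. 6.18] -/
theorem lam_signed_one_eq_of_mazurTate' (hp2 : p ≠ 2) (hf : IsNewformOf W f)
    (hgood : W.HasGoodReductionAtPrime p) (hap : W.frobeniusTrace p = 0)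
    {L : IwasawaAlgebra p} (hL : Kobayashi2003.IsSignedPAdicLFunction f p 1 L)
    {n : ℕ} (hn : Even n) {Θ : IwasawaAlgebra p}
    (hΘ : iwasawaToPowerSeries p Θ =
      ((mazurTateElement f p n).map (algebraMap ℚ ℚ_[p]) : PowerSeries ℚ_[p]))
    (hΘ0 : Θ ≠ 0) (hμ : mu Θ = 0) {l : ℕ}
    (hlam : lam Θ = (cyclotomicOmegaMinus p n).natDegree + l) : mu L = 0 ∧ lam L = l :=
  lam_signed_one_eq_of_mazurTate hp2 hf hgood hap hL hn hΘ hΘ0 hμ hlam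
    (lam_lt_of_mazurTate hΘ hΘ0 hμ)

end Automatic

end Summit.BirchSwinnertonDyer.Rank1Residual.Supersingular

end
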